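import Summits.CriticalPhenomena.PercolationContinuityZ3.Theorems.PercNearOneGluingNoHeavyQuantThetaPivotalPerimeter
import Summits.CriticalPhenomena.PercolationContinuityZ3.Theorems.PercNearOneGluingNoHeavyQuantThetaRightLipschitz
import Literature.Probability.Percolation.SiteConnectionTools
import Literature.Probability.Percolation.GrimmettMarstrand
import Literature.Probability.Percolation.AnchoredIsoperimetricProfileProofs
import HarnessLib

/-!
# QUANT lane (p4 gen 15): Durrett's inequality `θ'(p) ≤ θ(p)·E_p[|∂_E C|; |C| < ∞]/(1 − p)` on `(p_c, 1)`, every `d ≥ 2`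
# — the summation over the edges of `ℤ^d` of the per-edge bound (census V41′ of P4-MODULUS §18)

builds on p205010 (kernel theorem, internal audit signed; external expert review pending) — NOT used in this file.

R. Durrett, *Some general results concerning the critical exponents of percolation processes*, Z. Wahrsch. verw. Gebiete
69 (1985) 421–437, p. 435, eq. (5): `0 ≤ ∂M/∂p ≤ (1/(1−p))·M(p)·R(p)`, `R(p)` = the mean number of closed boundary edges of
the finite cluster of the origin through which `∞` is accessible, `R(p) ≤ κ S(p)`.  Gen 13 of this seat proved the
per-edge mechanism on any countable graph (`ThetaPerimeter.measure_isPivotal_percolatesAt_le`: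
`P(e pivotal for {o ↔ ∞}) ≤ [θ_b Σ_{S∋a,S∌b} P(K_o = S) + θ_a Σ_{S∋b,S∌a} P(K_o = S)]/(1−p)`); gen 9 proved Russo's formula
for the infinite cluster on `(p_c, 1)` (`ChiF.hasDerivAt_theta_pivotal`: `θ'(r) = Σ_e P_r(e ∈ E ∧ e pivotal for {0 ↔ ∞})`).
This file performs the SUMMATION over the edges of `ℤ^d` (translation invariance `θ_a = θ_b = θ`, exchange of the two
sums, `Σ_e 𝟙[e ∈ ∂_E S] = |∂_E S|`):

* (tree: `card_edgeBoundary_zdGraph_le` — `|∂_E S| ≤ 2d|S|` on `ℤ^d`);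
* `measure_pivotal_le_boundary_tsum` — per pair `e`: `P(e ∈ E ∧ e pivotal) ≤ (θ/(1−p))·Σ_S 𝟙[e ∈ ∂_E S] P(K = S)` (in `ℝ≥0∞`);
* **`tsum_pivotal_le_theta_mul_perimeter`** — `Σ_e P_p(e ∈ E ∧ e pivotal for {0↔∞}) ≤ (θ(p)/(1−p))·Σ_S |∂_E S| P_p(K = S)`
  (in `ℝ≥0∞`, every `p < 1`, every `d`);
* **`deriv_theta_le_theta_mul_perimeter`** — DURRETT'S (5), real form, `d ≥ 2`, `r ∈ (p_c,1)`:
  `θ'(r) ≤ θ(r)·E_r[|∂_E C|; |C| < ∞]/(1 − r)`, with `E_r[|∂_E C|; |C|<∞] = Σ_S |∂_E S|·P_r(K=S) ≤ 2d·χ^f(r) < ∞`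
  (`perimeter_tsum_le_two_d_mul_chiF`), recovering the tree's `θ' ≤ 2dθχ^f/(1−r)` (`ChiF.tsum_real_pivotal_two_sided`, obtained
  there by the Aizenman–Barsky transport) with the sharper perimeter in place of the volume.

HONEST: a REPRODUCTION (rigorous version on `(p_c,1)`) of a printed 1985 inequality; no rate, nothing at `p_c`.

## References
* R. Durrett, Z. Wahrsch. verw. Gebiete 69 (1985) 421–437, p. 435 eq. (5) [Durrett1985].
* G. Grimmett, *Percolation*, 2nd ed. (1999), Thm (2.25), Thm (8.92) [GrimmettPercolation1999].
-/

noncomputable section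

namespace Summit.CriticalPhenomena.PercolationContinuityZ3.Theorems.ThetaPerimeter

open MeasureTheory Literature.Probability.Percolation Literature.Probability.LatticeModels
open scoped ENNReal Classical

variable {d : ℕ}

/-! ### §1 Lattice bookkeeping -/

/-- Translation invariance: `θ_x(p) = θ_0(p)` on `ℤ^d`. -/
theorem theta_eq_theta_zero (x : Site d) (p : unitInterval) : theta (zdGraph d) x p = theta (zdGraph d) 0 p := by
  have h := theta_iso (zdShiftIso x) (0 : Site d) p
  simpa using h

/-- For an edge `s(a,b)` of `ℤ^d`: the two one-sided indicators add up to the indicator of the edge boundary,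
`𝟙[a ∈ S, b ∉ S] + 𝟙[b ∈ S, a ∉ S] = 𝟙[s(a,b) ∈ ∂_E S]`. -/
theorem ite_add_ite_eq_ite_edgeBoundary {a b : Site d} (he : s(a, b) ∈ (zdGraph d).edgeSet) (S : Finset (Site d))
    (c : ℝ≥0∞) :
    ((if a ∈ S ∧ b ∉ S then c else 0) + if b ∈ S ∧ a ∉ S then c else 0) =
      if s(a, b) ∈ edgeBoundary (zdGraph d) S then c else 0 := by
  have hmem : s(a, b) ∈ edgeBoundary (zdGraph d) S ↔ (a ∈ S ∧ b ∉ S) ∨ (b ∈ S ∧ a ∉ S) := by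
    rw [mem_edgeBoundary_iff]
    simp only [Sym2.mem_iff]
    constructor
    · rintro ⟨-, ⟨x, hx, rfl | rfl⟩, ⟨y, hy, rfl | rfl⟩⟩
      · exact absurd hx hy
      · exact Or.inl ⟨hx, hy⟩
      · exact Or.inr ⟨hx, hy⟩
      · exact absurd hx hy
    · rintro (⟨ha, hb⟩ | ⟨hb, ha⟩)
      · exact ⟨he, ⟨a, ha, Or.inl rfl⟩, ⟨b, hb, Or.inr rfl⟩⟩
      · exact ⟨he, ⟨b, hb, Or.inr rfl⟩, ⟨a, ha, Or.inl rfl⟩⟩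
  by_cases h1 : a ∈ S ∧ b ∉ S
  · have h2 : ¬(b ∈ S ∧ a ∉ S) := fun h => h.2 h1.1
    rw [if_pos h1, if_neg h2, if_pos (hmem.2 (Or.inl h1)), add_zero]
  · by_cases h2 : b ∈ S ∧ a ∉ S
    · rw [if_neg h1, if_pos h2, if_pos (hmem.2 (Or.inr h2)), zero_add]
    · have : ¬ s(a, b) ∈ edgeBoundary (zdGraph d) S := fun h => by
        rcases hmem.1 h with h | h
        · exact h1 h
        · exact h2 h
      rw [if_neg h1, if_neg h2, if_neg this, add_zero]

/-! ### §2 The per-pair bound with the boundary indicator -/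

/-- **Per pair**: for every `e : Sym2 ℤ^d` and `p < 1`,
`P_p(e ∈ E ∧ e pivotal for {0 ↔ ∞}) ≤ (θ(p)/(1−p)) · Σ_S 𝟙[e ∈ ∂_E S]·P_p(K_0 = S)` (in `ℝ≥0∞`) — gen 13's per-edge bound
with `θ_a = θ_b = θ` (translation invariance) and the two one-sided sums merged into the edge-boundary indicator; for a
non-edge the event is empty. -/
theorem measure_pivotal_le_boundary_tsum (p : unitInterval) (hp1 : (p : ℝ) < 1) (e : Sym2 (Site d)) :
    bondPercolation (zdGraph d) p {ω | e ∈ (zdGraph d).edgeSet ∧ IsPivotal (percolatesAt (0 : Site d)) e ω} ≤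
      ENNReal.ofReal (theta (zdGraph d) 0 p) / ENNReal.ofReal (1 - p) *
        ∑' S : Finset (Site d), if e ∈ edgeBoundary (zdGraph d) S then bondPercolation (zdGraph d) p (clusterIs 0 S) else 0 := by
  by_cases he : e ∈ (zdGraph d).edgeSet
  · induction e using Sym2.ind with
    | h a b =>
      have hset : {ω : BondConfig (Site d) | s(a, b) ∈ (zdGraph d).edgeSet ∧ IsPivotal (percolatesAt (0 : Site d)) s(a, b) ω}
          = {ω | IsPivotal (percolatesAt (0 : Site d)) s(a, b) ω} := by
        ext ω; simp [he]
      rw [hset]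
      refine (measure_isPivotal_percolatesAt_le (G := zdGraph d) (p := p) (0 : Site d) he hp1).trans (le_of_eq ?_)
      rw [theta_eq_theta_zero b p, theta_eq_theta_zero a p, ← add_mul, ← ENNReal.tsum_add,
        tsum_congr (fun S => ite_add_ite_eq_ite_edgeBoundary he S (bondPercolation (zdGraph d) p (clusterIs 0 S)))]
      simp only [div_eq_mul_inv]
      ring
  · have hset : {ω : BondConfig (Site d) | e ∈ (zdGraph d).edgeSet ∧ IsPivotal (percolatesAt (0 : Site d)) e ω} = ∅ := by
      ext ω; simp [he]
    rw [hset, measure_empty]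
    exact bot_le

/-! ### §3 Summation over the edges -/

/-- `Σ'_e 𝟙[e ∈ F]·c = |F|·c` in `ℝ≥0∞`. -/
theorem tsum_ite_mem_finset (F : Finset (Sym2 (Site d))) (c : ℝ≥0∞) :
    ∑' e : Sym2 (Site d), (if e ∈ F then c else 0) = F.card * c := by
  rw [tsum_eq_sum (s := F) (fun e he => if_neg he)]
  rw [Finset.sum_ite_mem, Finset.inter_self, Finset.sum_const, nsmul_eq_mul]

/-- **Durrett's bound summed over the edges (measure form, every `d`, every `p < 1`)**:
`Σ_e P_p(e ∈ E ∧ e pivotal for {0 ↔ ∞}) ≤ (θ(p)/(1−p)) · Σ_S |∂_E S|·P_p(K_0 = S)` in `ℝ≥0∞`.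
[cite: Durrett1985, p. 435 eq. (5)] -/
theorem tsum_pivotal_le_theta_mul_perimeter (p : unitInterval) (hp1 : (p : ℝ) < 1) :
    ∑' e : Sym2 (Site d), bondPercolation (zdGraph d) p
        {ω | e ∈ (zdGraph d).edgeSet ∧ IsPivotal (percolatesAt (0 : Site d)) e ω} ≤
      ENNReal.ofReal (theta (zdGraph d) 0 p) / ENNReal.ofReal (1 - p) *
        ∑' S : Finset (Site d), ((edgeBoundary (zdGraph d) S).card : ℝ≥0∞) * bondPercolation (zdGraph d) p (clusterIs 0 S) := by
  calc ∑' e : Sym2 (Site d), bondPercolation (zdGraph d) p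
          {ω | e ∈ (zdGraph d).edgeSet ∧ IsPivotal (percolatesAt (0 : Site d)) e ω}
      ≤ ∑' e : Sym2 (Site d), ENNReal.ofReal (theta (zdGraph d) 0 p) / ENNReal.ofReal (1 - p) *
          ∑' S : Finset (Site d),
            (if e ∈ edgeBoundary (zdGraph d) S then bondPercolation (zdGraph d) p (clusterIs 0 S) else 0) :=
        ENNReal.tsum_le_tsum fun e => measure_pivotal_le_boundary_tsum p hp1 e
    _ = ENNReal.ofReal (theta (zdGraph d) 0 p) / ENNReal.ofReal (1 - p) *
          ∑' S : Finset (Site d), ∑' e : Sym2 (Site d),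
            (if e ∈ edgeBoundary (zdGraph d) S then bondPercolation (zdGraph d) p (clusterIs 0 S) else 0) := by
        rw [ENNReal.tsum_mul_left, ENNReal.tsum_comm]
    _ = _ := by
        congr 1
        exact tsum_congr fun S => tsum_ite_mem_finset _ _

/-! ### §4 Real form on `(p_c, 1)`: Durrett's (5) -/

/-- `Σ_S |∂_E S| P_p(K = S) ≤ 2d · χ^f(p)` (in `ℝ≥0∞`). -/
theorem perimeter_tsum_le_two_d_mul_chiF (p : unitInterval) :
    ∑' S : Finset (Site d), ((edgeBoundary (zdGraph d) S).card : ℝ≥0∞) * bondPercolation (zdGraph d) p (clusterIs 0 S) ≤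
      2 * d * meanClusterSize (zdGraph d) (0 : Site d) p := by
  rw [ChiF.meanClusterSize_eq_tsum, ← ENNReal.tsum_mul_left]
  refine ENNReal.tsum_le_tsum fun S => ?_
  rw [← mul_assoc]
  gcongr
  exact_mod_cast card_edgeBoundary_zdGraph_le S

/-- **DURRETT'S INEQUALITY (1985, eq. (5)) on `ℤ^d`, `d ≥ 2`, at every `r ∈ (p_c, 1)`**:
`θ'(r) ≤ θ(r) · E_r[|∂_E C|; |C| < ∞] / (1 − r)`, where `E_r[|∂_E C|; |C| < ∞] = Σ_S |∂_E S|·P_r(K_0 = S)` is the mean edge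
perimeter of the finite cluster of the origin (finite: `≤ 2dχ^f(r)`, `perimeter_tsum_le_two_d_mul_chiF`, and `χ^f < ∞` on
`(p_c,1)` by Kesten–Zhang, `meanClusterSize_prm_lt_top`).  Russo's formula for `{0 ↔ ∞}` (`ChiF.hasDerivAt_theta_pivotal`) +
the summed per-edge bound.  Printed with `R(p) ≤` this perimeter ("closed boundary edges through which `∞` is accessible").
[cite: Durrett1985, p. 435 eq. (5)] -/
theorem deriv_theta_le_theta_mul_perimeter (hd : 2 ≤ d) {r : ℝ} (hr : r ∈ Set.Ioo (criticalProbI d : ℝ) 1) :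
    deriv (fun s : ℝ => theta (zdGraph d) 0 (GhostField.prm s)) r ≤
      theta (zdGraph d) 0 (GhostField.prm r) / (1 - r) *
        (∑' S : Finset (Site d), ((edgeBoundary (zdGraph d) S).card : ℝ≥0∞) *
          bondPercolation (zdGraph d) (GhostField.prm r) (clusterIs 0 S)).toReal := by
  set μ := bondPercolation (zdGraph d) (GhostField.prm r) with hμ
  have hr0 : 0 ≤ r := ((criticalProbI d).2.1).trans hr.1.le
  have hcoe : ((GhostField.prm r : unitInterval) : ℝ) = r := ChiF.coe_prm_eq hr0 hr.2.le
  have hp1 : ((GhostField.prm r : unitInterval) : ℝ) < 1 := by rw [hcoe]; exact hr.2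
  -- finiteness of the perimeter sum
  have hchi : meanClusterSize (zdGraph d) (0 : Site d) (GhostField.prm r) < ⊤ := ChiF.meanClusterSize_prm_lt_top hd hr.1 hr.2.le
  have hper : ∑' S : Finset (Site d), ((edgeBoundary (zdGraph d) S).card : ℝ≥0∞) * μ (clusterIs 0 S) ≠ ⊤ :=
    ne_top_of_le_ne_top (ENNReal.mul_ne_top (ENNReal.mul_ne_top (by norm_num) (ENNReal.natCast_ne_top d)) hchi.ne)
      (perimeter_tsum_le_two_d_mul_chiF _)
  -- the derivative as a real tsum = toReal of the `ℝ≥0∞` tsum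
  rw [ChiF.deriv_theta_eq_tsum_pivotal hd hr]
  have hterm : ∀ e : Sym2 (Site d), μ {ω | e ∈ (zdGraph d).edgeSet ∧ IsPivotal (percolatesAt (0 : Site d)) e ω} ≠ ⊤ :=
    fun e => measure_ne_top _ _
  have hreal : ∑' e : Sym2 (Site d), μ.real {ω | e ∈ (zdGraph d).edgeSet ∧ IsPivotal (percolatesAt (0 : Site d)) e ω} =
      (∑' e : Sym2 (Site d), μ {ω | e ∈ (zdGraph d).edgeSet ∧ IsPivotal (percolatesAt (0 : Site d)) e ω}).toReal := by
    rw [ENNReal.tsum_toReal_eq hterm]; rfl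
  rw [hreal]
  have hq : ENNReal.ofReal (1 - ((GhostField.prm r : unitInterval) : ℝ)) ≠ 0 := by
    rw [ENNReal.ofReal_ne_zero_iff]; linarith
  have h := tsum_pivotal_le_theta_mul_perimeter (d := d) (GhostField.prm r) hp1
  have hRHS : ENNReal.ofReal (theta (zdGraph d) 0 (GhostField.prm r)) / ENNReal.ofReal (1 - (GhostField.prm r : ℝ)) *
      ∑' S : Finset (Site d), ((edgeBoundary (zdGraph d) S).card : ℝ≥0∞) * μ (clusterIs 0 S) ≠ ⊤ :=
    ENNReal.mul_ne_top (ENNReal.div_ne_top ENNReal.ofReal_ne_top hq) hper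
  have := ENNReal.toReal_mono hRHS h
  have hθ0 : (0 : ℝ) ≤ theta (zdGraph d) 0 (GhostField.prm r) := measureReal_nonneg
  rw [ENNReal.toReal_mul, ENNReal.toReal_div, ENNReal.toReal_ofReal hθ0,
    ENNReal.toReal_ofReal (by linarith), hcoe] at this
  exact this

/-- **Consistency with the volume form**: on `(p_c,1)`,
`θ(r)·E_r[|∂_E C|;|C|<∞]/(1−r) ≤ 2d·θ(r)·χ^f(r)/(1−r)` — Durrett's perimeter bound implies the tree's
`θ' ≤ 2dθχ^f/(1−r)` (`ChiF.tsum_real_pivotal_two_sided`, Aizenman–Barsky transport). [cite: Durrett1985, p. 435 (R(p) ≤ κS(p))] -/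
theorem theta_mul_perimeter_le_volume (hd : 2 ≤ d) {r : ℝ} (hr : r ∈ Set.Ioo (criticalProbI d : ℝ) 1) :
    theta (zdGraph d) 0 (GhostField.prm r) / (1 - r) *
        (∑' S : Finset (Site d), ((edgeBoundary (zdGraph d) S).card : ℝ≥0∞) *
          bondPercolation (zdGraph d) (GhostField.prm r) (clusterIs 0 S)).toReal ≤
      2 * d * theta (zdGraph d) 0 (GhostField.prm r) *
        (meanClusterSize (zdGraph d) (0 : Site d) (GhostField.prm r)).toReal / (1 - r) := by
  have hchi : meanClusterSize (zdGraph d) (0 : Site d) (GhostField.prm r) < ⊤ := ChiF.meanClusterSize_prm_lt_top hd hr.1 hr.2.le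
  have h := ENNReal.toReal_mono (ENNReal.mul_ne_top (ENNReal.mul_ne_top (by norm_num) (ENNReal.natCast_ne_top d)) hchi.ne)
    (perimeter_tsum_le_two_d_mul_chiF (d := d) (GhostField.prm r))
  rw [ENNReal.toReal_mul] at h
  have h2d : ((2 : ℝ≥0∞) * d).toReal = 2 * d := by norm_num
  rw [h2d] at h
  have hθ0 : (0 : ℝ) ≤ theta (zdGraph d) 0 (GhostField.prm r) := measureReal_nonneg
  have hθ : 0 ≤ theta (zdGraph d) 0 (GhostField.prm r) / (1 - r) := div_nonneg hθ0 (by linarith [hr.2])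
  calc theta (zdGraph d) 0 (GhostField.prm r) / (1 - r) * _
      ≤ theta (zdGraph d) 0 (GhostField.prm r) / (1 - r) * (2 * d * (meanClusterSize (zdGraph d) (0 : Site d) (GhostField.prm r)).toReal) :=
        mul_le_mul_of_nonneg_left h hθ
    _ = _ := by ring

end Summit.CriticalPhenomena.PercolationContinuityZ3.Theorems.ThetaPerimeter

end
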